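import Literature.Combinatorics.LorentzianPolynomials.WordPolynomial
import Literature.LinearAlgebra.Matrix.MixedDiscriminantLorentzianSignature
import Literature.Topology.FourManifolds.LatticeFormsOrthoSumSignature
import HarnessLib

/-!
# The determinantal polynomial `det(w_1 A_1 + ⋯ + w_n A_n)` of positive definite hermitian matrices is
# Lorentzian (Brändén–Huh 2020, §2.1), through the mixed discriminants of words

Layer `Literature/LinearAlgebra/Matrix`, namespace `Literature.LinearAlgebra.Matrix`; lane `lit-hodgefound` (Track 2
foundations library), seat p16, generation 27 (row g27-#4). Sequel of
`Combinatorics/LorentzianPolynomials/WordPolynomial.lean` (row g27-#2: `wordPolynomial d F = Σ_u F(u) w_u`,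
**`wordPolynomial_mem_lorentzian`** — the common skeleton of Brändén–Huh's Thms. 4.1 / 4.6: a SYMMETRIC, POSITIVE function
of words whose `2`-slices have at most one positive eigenvalue gives a Lorentzian polynomial) and of the tree's
mixed-discriminant files `MixedDiscriminant` (`mixedDisc M = Σ_{σ,τ} sgn σ sgn τ Π_s M_s(σ s, τ s) = n!·D`),
`MixedDiscriminantAlexandrov` (`mixedDisc_const`, `mixedDisc_comp_equiv`, `mixedDisc_sum_eq_sum_pi`, reality and
positivity on hermitian / definite families; its docstring lists "TODO(general form): `m ≠ n` matrices of size `n`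
(pencils in `m` variables)" — done here) and `MixedDiscriminantLorentzianSignature` (the real bilinear form
`mixedDiscForm M hs = Re D(·, ·, 𝒞)` on hermitian matrices and its index:
`sigPos_mixedDiscForm_restrict_le_one_of_posSemidef`, Shenfeld–van Handel's Lemma 1.4).

## Sources (verbatim)

* P. Brändén, J. Huh, *Lorentzian polynomials*, Ann. of Math. 192 (2020) = arXiv:1902.03719 [BrandenHuh2019] (held
  `paper:arxiv-1902.03719`), §2.1, the paragraph after Proposition 2.2 ("Any polynomial in `S^d_n` is Lorentzian"):
  "All the nonzero coefficients of a homogeneous stable polynomial have the same sign [COSW04]. Thus, any homogeneous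
  stable polynomial is a constant multiple of a Lorentzian polynomial. For example, determinantal polynomials of the
  form `f(w_1, …, w_n) = det(w_1 A_1 + ⋯ + w_n A_n)`, where `A_1, …, A_n` are positive semidefinite matrices, are stable
  [BB08], and hence Lorentzian."; §2.2 Definition 2.6 (`L^d_n`, the tree's `lorentzian σ d`); §4.1 proof of Thm. 4.1 /
  §4.2 proof of Thm. 4.6 ("every coefficient of `vol` is positive. Thus, by Theorem 2.25, it is enough to show that
  `∂^α vol` is Lorentzian for every `α ∈ Δ^{d-2}_n`" — the shape vendored as `wordPolynomial_mem_lorentzian`).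
* R. B. Bapat, *Mixed discriminants of positive semidefinite matrices*, Linear Algebra Appl. 126 (1989) 107–124
  [Bapat1989], (1): "`det(λ_1 A^1 + ⋯ + λ_n A^n) = Σ λ_{i_1} ⋯ λ_{i_n} D(A^{i_1}, …, A^{i_n})`" — the mixed discriminant
  as the coefficient (polarization) of the determinant of a pencil; Lemma 2 (ii) symmetry, (iii) reality on hermitian
  families, (vi) nonnegativity on positive semidefinite families; §4 Theorem 9 (positivity for positive definite
  families).
* Y. Shenfeld, R. van Handel, *Mixed volumes and the Bochner method*, Proc. AMS 147 (2019) [ShenfeldVanHandel2019],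
  §1.2 Theorem 1.3 (Alexandrov's inequality for mixed discriminants) and **Lemma 1.4** ("The positive eigenspace of
  `A` has dimension at most one") — the hyperbolicity of `X ↦ D(X, X, M_1, …, M_{n-2})` on hermitian matrices, which
  replaces the Hodge index theorem of Thm. 4.6 / the Alexandrov–Fenchel inequality of Thm. 4.1 in the present
  instance of the skeleton.
* J. Borcea, P. Brändén, *Applications of stable polynomials to mixed determinants*, Duke Math. J. 143 (2008)
  [BorceaBranden2008], Prop. 2.4 (the stability "[BB08]" quoted by Brändén–Huh; in the tree as
  `isUpperHalfPlaneStable_detPencil` / `detPencil_eq_zero_or_isUpperHalfPlaneStable` for pencils in `|ι|` variables).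

## The road taken (deviation from the printed proof, and why)

Brändén–Huh obtain the statement from two inputs the tree does not have in the required form: half-plane stability of
`det(Σ w_i A_i)` in `n` variables for `m × m` matrices (the tree's `detPencil` has as many variables as the matrix has
rows), and Proposition 2.2 `S^d_n ⊆ L^d_n`, whose proof runs through Definition 2.1 (limits of strictly Lorentzian
polynomials, Nuij's theorem) — the tree's `lorentzian σ d` is Definition 2.6. Here the membership
`det(Σ w_i A_i) ∈ L^d_n` (Definition 2.6) is proved DIRECTLY by the argument Brändén–Huh use for Theorems 4.1 and 4.6,
with mixed discriminants in place of mixed volumes / intersection numbers: expanding the determinant of the pencil,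
`d! · det(Σ_i w_i A_i) = Σ_{u ∈ [n]^d} D(A_{u_1}, …, A_{u_d}) w_{u_1} ⋯ w_{u_d}` (Bapat (1)); the word function
`u ↦ D(A_{u_1}, …, A_{u_d})` is symmetric (Bapat Lemma 2 (ii)), positive for positive definite `A_i` (Bapat Thm. 9),
and its `2`-slices `(a, b) ↦ D(A_{τ_1}, …, A_{τ_{d-2}}, A_a, A_b)` are pull-backs of the hyperbolic form
`(X, Y) ↦ D(X, Y, 𝒞)` on hermitian matrices (Shenfeld–van Handel Lemma 1.4, tree: `sigPos ≤ 1`), so they have at most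
one positive eigenvalue; `wordPolynomial_mem_lorentzian` concludes. Positive DEFINITENESS is what the full-support
form of the skeleton needs (`D(A_i, …, A_i) = d!·det A_i > 0`); the positive SEMIdefinite statement printed by
Brändén–Huh needs in addition the M-convexity of the support of a determinantal polynomial and is not claimed:
TODO(general form): positive semidefinite `A_i` (support = an M-convex proper subset of `Δ^d_n`).

## What is here (`A : σ → Matrix ι ι ℂ` a finite family of square matrices, `d = |ι|`, variables `w_i`, `i ∈ σ`)

* §1 `mixedDiscWord A e u = Re D(A_{u_1}, …, A_{u_d})` for a word `u ∈ σ^d` (slots of the tree's `mixedDisc` are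
  indexed by `ι`; `e : ι ≃ Fin d` reads a word as a family) — `mixedDiscWord_comp_perm` (symmetric), `coe_mixedDiscWord`
  (real on hermitian families), `mixedDiscWord_nonneg` / **`mixedDiscWord_pos`** (semidefinite / definite families).
* §2 the expansion of the pencil determinant: `mixedDisc_const_sum_smul`, **`sum_prod_mul_mixedDisc_word`**
  (`Σ_u (Π_k w_{u_k}) D(A_u) = d! · det(Σ_i w_i A_i)`), `eval_wordPolynomial_mixedDiscWord`.
* §3 **`detPolynomial A ∈ ℝ[w_i : i ∈ σ]`**, the real polynomial with `detPolynomial A (w) = Re det(Σ_i w_i A_i)`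
  (`eval_detPolynomial`; `= det(Σ_i w_i A_i)` itself on hermitian families, `coe_eval_detPolynomial`), characterised by
  its values (`eq_detPolynomial_of_eval_eq`); `isHomogeneous_detPolynomial`, `coeff_detPolynomial(_nonneg/_pos)`.
* §4 the `2`-slices (variable slots `e⁻¹(m)`, `e⁻¹(m+1)`, background `𝒞_τ = (A_{τ_k})_k`):
  **`mixedDiscWord_append_two`** (`D(A_τ, A_a, A_b) = mixedDiscForm 𝒞_τ (A_a) (A_b)`), `toBilin'_slice_apply`,
  **`sigPos_slice_le_one`** (private plumbing: `apply_append_two`, `update_update_append`, `posSemidef_append`).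
* §5 **`wordPolynomial_mixedDiscWord_mem_lorentzian`** (`Σ_u D(A_u) w_u ∈ L^d_n`) and
  **`detPolynomial_mem_lorentzian`**: for positive definite hermitian `A_i`, `det(Σ_i w_i A_i) ∈ L^d_n` — every matrix
  size `d`, any finite number of matrices.
* §6 corollary (diagonal `A_i`): `prod_linearForm_eq_detPolynomial`, **`prod_linearForm_mem_lorentzian`** — a product
  of `d` linear forms with positive coefficients `Π_s (Σ_i c_{s,i} w_i)` is in `L^d_n`.

Two definitions with bodies (`mixedDiscWord`, `detPolynomial`), theorems otherwise; no `sorry`, no named fact (net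
debt 0).

## References

* [BrandenHuh2019] P. Brändén, J. Huh, *Lorentzian polynomials*, Ann. of Math. (2) 192 (2020) 821–891,
  arXiv:1902.03719 — §2.1 Prop. 2.2 and the determinantal example after it; §2.2 Def. 2.6; §4.1–4.2 proofs of
  Thms. 4.1, 4.6.
* [Bapat1989] R. B. Bapat, Linear Algebra Appl. 126 (1989) 107–124 — (1), Lemma 2 (ii), (iii), (vi), §4 Theorem 9.
* [ShenfeldVanHandel2019] Y. Shenfeld, R. van Handel, Proc. AMS 147 (2019) — §1.2 Thm. 1.3, Lemma 1.4.
* [BorceaBranden2008] J. Borcea, P. Brändén, Duke Math. J. 143 (2008) — Prop. 2.4.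
-/

noncomputable section

open scoped ComplexOrder
open Finset Function Complex Matrix Module MvPolynomial QuadraticMap
open Literature.Combinatorics.LorentzianPolynomials

namespace Literature.LinearAlgebra.Matrix

variable {ι : Type*} [Fintype ι] [DecidableEq ι] {σ : Type*}

/-! ## §1 The mixed discriminant `D(A_{u_1}, …, A_{u_d})` of a word -/

section Word

variable (A : σ → Matrix ι ι ℂ) {d : ℕ} (e : ι ≃ Fin d)

/-- **The mixed discriminant of a word** `u = (u_1, …, u_d) ∈ σ^d` in the matrices `A_i`:
`Re D(A_{u_1}, …, A_{u_d})` in the tree's normalisation `mixedDisc = d! · D` (slot `s : ι` of the family carries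
`A_{u_{e s}}`, `e : ι ≃ Fin d` an enumeration of the slots; the real part is the value itself on hermitian families,
`coe_mixedDiscWord`). Bapat: "`D(A^{i_1}, …, A^{i_n})`". [cite: Bapat1989, (1)] -/
def mixedDiscWord (u : Fin d → σ) : ℝ :=
  (mixedDisc fun s ↦ A (u (e s))).re

/-- `mixedDiscWord A e u = Re mixedDisc (s ↦ A_{u_{e s}})`. [cite: Bapat1989, (1)] -/
theorem mixedDiscWord_def (u : Fin d → σ) : mixedDiscWord A e u = (mixedDisc fun s ↦ A (u (e s))).re := rfl

/-- **The mixed discriminant of a word is symmetric in its letters** ("`D` is symmetric in its arguments"; tree: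
`mixedDisc_comp_equiv`). [cite: Bapat1989, Lemma 2 (ii)] -/
theorem mixedDiscWord_comp_perm (u : Fin d → σ) (π : Equiv.Perm (Fin d)) :
    mixedDiscWord A e (u ∘ π) = mixedDiscWord A e u := by
  rw [mixedDiscWord, mixedDiscWord, ← mixedDisc_comp_equiv (fun s ↦ A (u (e s))) (e.trans (π.trans e.symm))]
  simp only [Equiv.trans_apply, Equiv.apply_symm_apply, Function.comp_apply]

/-- On hermitian matrices the mixed discriminant of a word is real:
`(mixedDiscWord A e u : ℂ) = D(A_{u_1}, …, A_{u_d})`. [cite: Bapat1989, Lemma 2 (iii)] -/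
theorem coe_mixedDiscWord (hA : ∀ i, (A i).IsHermitian) (u : Fin d → σ) :
    (mixedDiscWord A e u : ℂ) = mixedDisc fun s ↦ A (u (e s)) :=
  (mixedDisc_eq_re_of_isHermitian _ fun _ ↦ hA _).symm

/-- `D(A_{u_1}, …, A_{u_d}) ≥ 0` for positive semidefinite `A_i`. [cite: Bapat1989, Lemma 2 (vi)] -/
theorem mixedDiscWord_nonneg (hA : ∀ i, (A i).PosSemidef) (u : Fin d → σ) : 0 ≤ mixedDiscWord A e u :=
  mixedDisc_re_nonneg_of_posSemidef _ fun _ ↦ hA _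

/-- **`D(A_{u_1}, …, A_{u_d}) > 0` for positive definite `A_i`** (tree: `mixedDisc_re_pos_of_posDef`) — the word
function has FULL support. [cite: Bapat1989, §4 Theorem 9 (positive definite case)] -/
theorem mixedDiscWord_pos (hA : ∀ i, (A i).PosDef) (u : Fin d → σ) : 0 < mixedDiscWord A e u :=
  mixedDisc_re_pos_of_posDef _ fun _ ↦ hA _

end Word

/-! ## §2 The expansion `d! · det(Σ_i w_i A_i) = Σ_u D(A_{u_1}, …, A_{u_d}) w_{u_1} ⋯ w_{u_d}` -/

section Expansion

variable [Fintype σ] [DecidableEq σ] (A : σ → Matrix ι ι ℂ) {d : ℕ} (e : ι ≃ Fin d)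

/-- **Multilinear expansion of the diagonal**: `D(Σ_i w_i A_i, …, Σ_i w_i A_i) = Σ_{γ : ι → σ} (Π_s w_{γ_s}) D((A_{γ_s})_s)`
(tree: `mixedDisc_sum_eq_sum_pi`, `mixedDisc_smul_eq_prod_mul`). [cite: Bapat1989, (1) and Lemma 2 (vii)] -/
theorem mixedDisc_const_sum_smul (w : σ → ℂ) :
    mixedDisc (fun _ : ι ↦ ∑ i, w i • A i) = ∑ γ : ι → σ, (∏ s, w (γ s)) * mixedDisc fun s ↦ A (γ s) := by
  rw [mixedDisc_sum_eq_sum_pi (fun (_ : ι) i ↦ w i • A i), Fintype.piFinset_univ]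
  exact Finset.sum_congr rfl fun γ _ ↦ mixedDisc_smul_eq_prod_mul (fun s ↦ w (γ s)) fun s ↦ A (γ s)

/-- **Bapat's formula (1)**, `d! · det(Σ_i w_i A_i) = Σ_{u ∈ σ^d} w_{u_1} ⋯ w_{u_d} · D(A_{u_1}, …, A_{u_d})`
("`det(λ_1 A^1 + ⋯ + λ_n A^n) = Σ λ_{i_1} ⋯ λ_{i_n} D(A^{i_1}, …, A^{i_n})`", tree normalisation `mixedDisc = d!·D`,
`mixedDisc_const`). [cite: Bapat1989, (1)] -/
theorem sum_prod_mul_mixedDisc_word (w : σ → ℂ) :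
    ∑ u : Fin d → σ, (∏ k, w (u k)) * mixedDisc (fun s ↦ A (u (e s))) =
      (d.factorial : ℂ) * (∑ i, w i • A i).det := by
  have hcard : Fintype.card ι = d := by rw [Fintype.card_congr e, Fintype.card_fin]
  rw [show (d.factorial : ℂ) = ((Fintype.card ι).factorial : ℂ) by rw [hcard], ← mixedDisc_const,
    mixedDisc_const_sum_smul]
  refine Fintype.sum_equiv (Equiv.arrowCongr e (Equiv.refl σ)).symm _ _ fun u ↦ ?_
  have hE : (Equiv.arrowCongr e (Equiv.refl σ)).symm u = u ∘ e := by
    funext s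
    simp [Equiv.arrowCongr]
  rw [hE]
  simp only [Function.comp_apply]
  congr 1
  exact (Fintype.prod_equiv e (fun s ↦ w (u (e s))) (fun k ↦ w (u k)) fun _ ↦ rfl).symm

/-- The polynomial of the word function evaluates to `d! · Re det(Σ_i w_i A_i)`:
`(Σ_u D(A_u) w_u)(w) = d! · Re det(Σ_i w_i A_i)`. [cite: Bapat1989, (1)] [cite: BrandenHuh2019, §4.1 (p. 46, "`Σ_{i_1,…,i_d}
V(K_{i_1},…,K_{i_d}) w_{i_1}⋯w_{i_d}`")] -/
theorem eval_wordPolynomial_mixedDiscWord (w : σ → ℝ) :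
    eval w (wordPolynomial d (mixedDiscWord A e)) = d.factorial * (∑ i, (w i : ℂ) • A i).det.re := by
  rw [eval_wordPolynomial]
  have key : ∀ u : Fin d → σ, ((∏ k, (w (u k) : ℂ)) * mixedDisc (fun s ↦ A (u (e s)))).re =
      mixedDiscWord A e u * ∏ k, w (u k) := fun u ↦ by
    rw [← Complex.ofReal_prod, Complex.re_ofReal_mul, mixedDiscWord, mul_comm]
  calc ∑ u : Fin d → σ, mixedDiscWord A e u * ∏ k, w (u k)
      = (∑ u : Fin d → σ, (∏ k, (w (u k) : ℂ)) * mixedDisc (fun s ↦ A (u (e s)))).re := by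
        rw [Complex.re_sum]
        exact Finset.sum_congr rfl fun u _ ↦ (key u).symm
    _ = d.factorial * (∑ i, (w i : ℂ) • A i).det.re := by
        rw [sum_prod_mul_mixedDisc_word A e (fun i ↦ (w i : ℂ)), ← Complex.ofReal_natCast, Complex.re_ofReal_mul]

omit [Fintype ι] [DecidableEq ι] [DecidableEq σ] in
/-- A real combination of hermitian matrices is hermitian. [cite: Bapat1989, Lemma 2 (iii)] -/
theorem isHermitian_sum_smul (hA : ∀ i, (A i).IsHermitian) (w : σ → ℝ) : (∑ i, (w i : ℂ) • A i).IsHermitian := by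
  have h : ∑ i, (w i : ℂ) • A i ∈ selfAdjoint.submodule ℝ (Matrix ι ι ℂ) :=
    Submodule.sum_mem _ fun i _ ↦ by
      rw [Complex.coe_smul]
      exact Submodule.smul_mem _ _ (mem_selfAdjoint_submodule_iff_isHermitian.2 (hA i))
  exact mem_selfAdjoint_submodule_iff_isHermitian.1 h

omit [DecidableEq σ] in
/-- The determinant of a real combination of hermitian matrices is real (`det Aᴴ = conj (det A)`).
[cite: Bapat1989, Lemma 2 (iii)] -/
theorem det_sum_smul_im (hA : ∀ i, (A i).IsHermitian) (w : σ → ℝ) : (∑ i, (w i : ℂ) • A i).det.im = 0 := by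
  have h := Matrix.det_conjTranspose (∑ i, (w i : ℂ) • A i)
  rw [(isHermitian_sum_smul A hA w).eq] at h
  exact Complex.conj_eq_iff_im.1 h.symm

end Expansion

/-! ## §3 The determinantal polynomial `det(Σ_i w_i A_i) ∈ ℝ[w]` -/

section DetPolynomial

variable [Fintype σ] (A : σ → Matrix ι ι ℂ)

/-- **The determinantal polynomial** `f(w_1, …, w_n) = det(w_1 A_1 + ⋯ + w_n A_n) ∈ ℝ[w_1, …, w_n]` of a finite family of
square matrices `A_i ∈ M_d(ℂ)` — as a real polynomial: `(1/d!) Σ_{u ∈ σ^d} Re D(A_{u_1}, …, A_{u_d}) w_{u_1} ⋯ w_{u_d}`, whose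
value at `w` is `Re det(Σ_i w_i A_i)` (`eval_detPolynomial`; `= det(Σ_i w_i A_i)` for hermitian `A_i`,
`coe_eval_detPolynomial`), and which is determined by these values (`eq_detPolynomial_of_eval_eq`).
[cite: BrandenHuh2019, §2.1 after Prop. 2.2 ("`f(w_1, …, w_n) = det(w_1 A_1 + ⋯ + w_n A_n)`")] [cite: Bapat1989, (1)] -/
def detPolynomial : MvPolynomial σ ℝ :=
  ((Fintype.card ι).factorial : ℝ)⁻¹ • wordPolynomial (Fintype.card ι) (mixedDiscWord A (Fintype.equivFin ι))

/-- `detPolynomial A` unfolded. [cite: Bapat1989, (1)] -/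
theorem detPolynomial_def : detPolynomial A =
    ((Fintype.card ι).factorial : ℝ)⁻¹ • wordPolynomial (Fintype.card ι) (mixedDiscWord A (Fintype.equivFin ι)) := rfl

/-- `det(Σ_i w_i A_i)` is homogeneous of degree `d`. [cite: BrandenHuh2019, §2.1 after Prop. 2.2 ("homogeneous stable
polynomial")] -/
theorem isHomogeneous_detPolynomial : (detPolynomial A).IsHomogeneous (Fintype.card ι) :=
  (homogeneousSubmodule σ ℝ _).smul_mem _ (isHomogeneous_wordPolynomial _)

variable [DecidableEq σ]

/-- **`detPolynomial A (w) = Re det(Σ_i w_i A_i)`.** [cite: BrandenHuh2019, §2.1 after Prop. 2.2] [cite: Bapat1989, (1)] -/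
theorem eval_detPolynomial (w : σ → ℝ) : eval w (detPolynomial A) = (∑ i, (w i : ℂ) • A i).det.re := by
  rw [detPolynomial, smul_eval, eval_wordPolynomial_mixedDiscWord, ← mul_assoc,
    inv_mul_cancel₀ (Nat.cast_ne_zero.2 (Nat.factorial_ne_zero _)), one_mul]

/-- For hermitian `A_i` the value is the determinant itself: `(detPolynomial A (w) : ℂ) = det(Σ_i w_i A_i)`.
[cite: BrandenHuh2019, §2.1 after Prop. 2.2] [cite: Bapat1989, Lemma 2 (iii)] -/
theorem coe_eval_detPolynomial (hA : ∀ i, (A i).IsHermitian) (w : σ → ℝ) :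
    ((eval w (detPolynomial A) : ℝ) : ℂ) = (∑ i, (w i : ℂ) • A i).det := by
  rw [eval_detPolynomial]
  exact Complex.ext (by rw [Complex.ofReal_re]) (by rw [Complex.ofReal_im, det_sum_smul_im A hA w])

/-- **The determinantal polynomial is characterised by its values**: a real polynomial that evaluates to
`Re det(Σ_i w_i A_i)` at every real point is `detPolynomial A` (`ℝ` is infinite). [cite: BrandenHuh2019, §2.1 after
Prop. 2.2] -/
theorem eq_detPolynomial_of_eval_eq {P : MvPolynomial σ ℝ} (hP : ∀ w : σ → ℝ, eval w P = (∑ i, (w i : ℂ) • A i).det.re) :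
    P = detPolynomial A :=
  MvPolynomial.funext fun w ↦ by rw [hP, eval_detPolynomial]

/-- The coefficients of `det(Σ_i w_i A_i)`: `coeff_α = (1/d!) Σ_{content u = α} Re D(A_{u_1}, …, A_{u_d})` (`= D_α/α!`·const after
symmetrisation). [cite: Bapat1989, (1)] -/
theorem coeff_detPolynomial (α : σ →₀ ℕ) : coeff α (detPolynomial A) =
    ((Fintype.card ι).factorial : ℝ)⁻¹ *
      ∑ u : Fin (Fintype.card ι) → σ, if content u = α then mixedDiscWord A (Fintype.equivFin ι) u else 0 := by
  rw [detPolynomial, coeff_smul, coeff_wordPolynomial, smul_eq_mul]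

/-- For positive semidefinite `A_i` every coefficient of `det(Σ_i w_i A_i)` is nonnegative ("All the nonzero
coefficients of a homogeneous stable polynomial have the same sign"). [cite: BrandenHuh2019, §2.1 after Prop. 2.2]
[cite: Bapat1989, Lemma 2 (vi)] -/
theorem coeff_detPolynomial_nonneg (hA : ∀ i, (A i).PosSemidef) (α : σ →₀ ℕ) : 0 ≤ coeff α (detPolynomial A) := by
  rw [detPolynomial, coeff_smul, smul_eq_mul]
  exact mul_nonneg (inv_nonneg.2 (Nat.cast_nonneg _))
    (coeff_wordPolynomial_nonneg (fun u ↦ mixedDiscWord_nonneg A _ hA u) α)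

/-- For positive DEFINITE `A_i` every monomial of degree `d` occurs in `det(Σ_i w_i A_i)` with a positive coefficient
(full support `Δ^d_n`). [cite: Bapat1989, §4 Theorem 9] [cite: BrandenHuh2019, §4.2 proof of Thm. 4.6 ("every
coefficient […] is positive")] -/
theorem coeff_detPolynomial_pos (hA : ∀ i, (A i).PosDef) (u : Fin (Fintype.card ι) → σ) :
    0 < coeff (content u) (detPolynomial A) := by
  rw [detPolynomial, coeff_smul, smul_eq_mul]
  exact mul_pos (inv_pos.2 (Nat.cast_pos.2 (Nat.factorial_pos _)))
    ((coeff_wordPolynomial_pos_iff (mixedDiscWord_pos A _ hA)).2 ⟨u, rfl⟩)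

end DetPolynomial

/-! ## §4 The `2`-slices `(a, b) ↦ D(A_τ, A_a, A_b)` are pull-backs of the hyperbolic form `D(·, ·, 𝒞)` -/

section Slices

variable [Fintype σ] [DecidableEq σ] (A : σ → Matrix ι ι ℂ) {m : ℕ} (e : ι ≃ Fin (m + 2))

omit [Fintype σ] [DecidableEq σ] in
/-- Post-composition commutes with appending a two-letter word: `f((τ, a, b)_j) = (f∘τ, f a, f b)_j`. [folklore] -/
private theorem apply_append_two {β : Type*} (f : σ → β) (τ : Fin m → σ) (a b : σ) (j : Fin (m + 2)) :
    f (Fin.append τ ![a, b] j) = Fin.append (fun k ↦ f (τ k)) ![f a, f b] j := by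
  refine Fin.addCases (fun k ↦ ?_) (fun l ↦ ?_) j
  · rw [Fin.append_left, Fin.append_left]
  · rw [Fin.append_right, Fin.append_right]
    fin_cases l <;> rfl

omit [Fintype ι] [DecidableEq ι] in
/-- The two variable slots `e⁻¹(m)`, `e⁻¹(m+1)` of a word `(τ, a, b)` are distinct. [folklore] -/
private theorem symm_natAdd_zero_ne (e : ι ≃ Fin (m + 2)) : e.symm (Fin.natAdd m 0) ≠ e.symm (Fin.natAdd m 1) := fun h ↦ by
  have h' := Fin.ext_iff.1 (e.symm.injective h)
  simp at h'

omit [Fintype ι] in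
/-- Updating the two variable slots of the background family `(A_{τ_1}, …, A_{τ_m}, X₀, Y₀)` by `X`, `Y` gives the
family of the word `(τ, X, Y)`. [folklore] -/
private theorem update_update_append (T : Fin m → Matrix ι ι ℂ) (X₀ Y₀ X Y : Matrix ι ι ℂ) :
    update (update (fun s ↦ Fin.append T ![X₀, Y₀] (e s)) (e.symm (Fin.natAdd m 0)) X) (e.symm (Fin.natAdd m 1)) Y =
      fun s ↦ Fin.append T ![X, Y] (e s) := by
  funext s
  obtain ⟨j, rfl⟩ := e.symm.surjective s
  simp only [Equiv.apply_symm_apply]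
  rcases eq_or_ne j (Fin.natAdd m 1) with rfl | h1
  · rw [update_self, Fin.append_right]; rfl
  rw [update_of_ne (e.symm.injective.ne h1)]
  rcases eq_or_ne j (Fin.natAdd m 0) with rfl | h0
  · rw [update_self, Fin.append_right]; rfl
  rw [update_of_ne (e.symm.injective.ne h0)]
  have hj := j.isLt
  have h1' : (j : ℕ) ≠ m + 1 := fun h ↦ h1 (Fin.ext (by simp [h]))
  have h0' : (j : ℕ) ≠ m := fun h ↦ h0 (Fin.ext (by simp [h]))
  obtain ⟨k, rfl⟩ : ∃ k : Fin m, Fin.castAdd 2 k = j := ⟨⟨j, by omega⟩, Fin.ext rfl⟩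
  simp only [Equiv.apply_symm_apply, Fin.append_left]

omit [Fintype σ] [DecidableEq σ] in
/-- **The `2`-slices of the word function are values of the mixed discriminant form**:
`D(A_{τ_1}, …, A_{τ_m}, A_a, A_b) = mixedDiscForm 𝒞_τ (A_a) (A_b)`, `𝒞_τ = (A_{τ_k})_k` the background (the junk entries
`0` of the two variable slots are overwritten). Brändén–Huh: "`(2!/d!) ∂^α vol(w) = V(Σ_i w_i K_i, Σ_i w_i K_i, K_1, …, K_n)`".
[cite: BrandenHuh2019, §4.1 proof of Thm. 4.1 (p. 47)] [cite: ShenfeldVanHandel2019, §1.2 before Lemma 1.4 ("the quadratic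
form `(A, B) ↦ D(A, B, M_1, …, M_{n-3})`")] -/
theorem mixedDiscWord_append_two (τ : Fin m → σ) (a b : σ)
    (hs : e.symm (Fin.natAdd m 0) ≠ e.symm (Fin.natAdd m 1)) :
    mixedDiscWord A e (Fin.append τ ![a, b]) =
      mixedDiscForm (fun s ↦ Fin.append (fun k ↦ A (τ k)) ![0, 0] (e s)) hs (A a) (A b) := by
  rw [mixedDiscForm_apply, update_update_append, mixedDiscWord]
  congr 2
  funext s
  exact apply_append_two A τ a b (e s)

/-- The bilinear form of the slice matrix `(D(A_τ, A_a, A_b))_{a,b}` is the mixed discriminant form on the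
combinations: `Σ_{a,b} v_a D(A_τ, A_a, A_b) w_b = D(Σ_a v_a A_a, Σ_b w_b A_b, 𝒞_τ)`. [cite: BrandenHuh2019, §4.1 proof of
Thm. 4.1 (p. 47)] [cite: Bapat1989, (1) (multilinearity)] -/
theorem toBilin'_slice_apply (τ : Fin m → σ) (hs : e.symm (Fin.natAdd m 0) ≠ e.symm (Fin.natAdd m 1))
    (v w : σ → ℝ) :
    Matrix.toBilin' (Matrix.of fun a b : σ ↦ mixedDiscWord A e (Fin.append τ ![a, b])) v w =
      mixedDiscForm (fun s ↦ Fin.append (fun k ↦ A (τ k)) ![0, 0] (e s)) hs (∑ a, v a • A a) (∑ b, w b • A b) := by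
  rw [Matrix.toBilin'_apply]
  simp only [Matrix.of_apply, mixedDiscWord_append_two A e τ _ _ hs, map_sum, map_smul, LinearMap.sum_apply,
    LinearMap.smul_apply, smul_eq_mul, Finset.mul_sum]
  rw [Finset.sum_comm]
  refine Finset.sum_congr rfl fun a _ ↦ Finset.sum_congr rfl fun b _ ↦ ?_
  ring

omit [Fintype ι] [DecidableEq ι] [Fintype σ] [DecidableEq σ] in
/-- The background family `(A_{τ_1}, …, A_{τ_m}, 0, 0)` is positive semidefinite when the `A_i` are. [folklore] -/
private theorem posSemidef_append (hA : ∀ i, (A i).PosSemidef) (τ : Fin m → σ) (s : ι) :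
    (Fin.append (fun k ↦ A (τ k)) ![(0 : Matrix ι ι ℂ), 0] (e s)).PosSemidef := by
  refine Fin.addCases (fun k ↦ ?_) (fun l ↦ ?_) (e s)
  · rw [Fin.append_left]; exact hA _
  · rw [Fin.append_right]
    fin_cases l <;> exact Matrix.PosSemidef.zero

/-- **Every `2`-slice `(a, b) ↦ D(A_τ, A_a, A_b)` has at most one positive eigenvalue** (positive semidefinite hermitian
`A_i`): it is the pull-back of `X ↦ D(X, X, 𝒞_τ)` on hermitian matrices — `sigPos ≤ 1` by Shenfeld–van Handel's Lemma 1.4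
(tree: `sigPos_mixedDiscForm_restrict_le_one_of_posSemidef`) — along `v ↦ Σ_a v_a A_a`, and the positive index does not
increase under pull-back (tree: `LinearMap.BilinForm.sigPos_le_sigPos_of_comp`). This is the Hodge-index input of the
skeleton ("the displayed quadratic form has exactly one positive eigenvalue"). [cite: ShenfeldVanHandel2019, §1.2 Thm. 1.3
and Lemma 1.4] [cite: BrandenHuh2019, §4.2 proof of Thm. 4.6 (pp. 49–50)] -/
theorem sigPos_slice_le_one (hA : ∀ i, (A i).PosSemidef) (τ : Fin m → σ) :
    sigPos (Matrix.toBilin' (Matrix.of fun a b : σ ↦ mixedDiscWord A e (Fin.append τ ![a, b]))).toQuadraticMap ≤ 1 := by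
  set M₀ : ι → Matrix ι ι ℂ := fun s ↦ Fin.append (fun k ↦ A (τ k)) ![0, 0] (e s) with hM₀
  have hs := symm_natAdd_zero_ne e
  have hindex : sigPos ((mixedDiscForm M₀ hs).restrict (selfAdjoint.submodule ℝ (Matrix ι ι ℂ))).toQuadraticMap ≤ 1 :=
    sigPos_mixedDiscForm_restrict_le_one_of_posSemidef M₀ hs fun s _ _ ↦ posSemidef_append A e hA τ s
  -- the linear map `v ↦ Σ v_a A_a` into the hermitian matrices
  have hmem : ∀ v : σ → ℝ, Fintype.linearCombination ℝ A v ∈ selfAdjoint.submodule ℝ (Matrix ι ι ℂ) := fun v ↦ by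
    rw [Fintype.linearCombination_apply]
    exact Submodule.sum_mem _ fun a _ ↦
      Submodule.smul_mem _ _ (mem_selfAdjoint_submodule_iff_isHermitian.2 (hA a).isHermitian)
  have hLv : ∀ v : σ → ℝ, ((LinearMap.codRestrict _ (Fintype.linearCombination ℝ A) hmem v :
      ↥(selfAdjoint.submodule ℝ (Matrix ι ι ℂ))) : Matrix ι ι ℂ) = ∑ a, v a • A a := fun v ↦ by
    rw [LinearMap.codRestrict_apply, Fintype.linearCombination_apply]
  have hcomp : ∀ v w : σ → ℝ,
      ((mixedDiscForm M₀ hs).restrict (selfAdjoint.submodule ℝ (Matrix ι ι ℂ)))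
        (LinearMap.codRestrict _ (Fintype.linearCombination ℝ A) hmem v)
        (LinearMap.codRestrict _ (Fintype.linearCombination ℝ A) hmem w) =
      Matrix.toBilin' (Matrix.of fun a b : σ ↦ mixedDiscWord A e (Fin.append τ ![a, b])) v w := by
    intro v w
    rw [LinearMap.BilinForm.restrict_apply, LinearMap.domRestrict_apply, hLv, hLv, toBilin'_slice_apply A e τ hs]
  exact (LinearMap.BilinForm.sigPos_le_sigPos_of_comp _ _
    (LinearMap.codRestrict _ (Fintype.linearCombination ℝ A) hmem) hcomp).trans hindex

end Slices

/-! ## §5 `det(Σ_i w_i A_i) ∈ L^d_n` for positive definite hermitian `A_i` -/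

section Lorentzian

variable [Fintype σ] [DecidableEq σ] (A : σ → Matrix ι ι ℂ)

/-- **`Σ_u D(A_{u_1}, …, A_{u_d}) w_u = d! · det(Σ_i w_i A_i) ∈ L^d_n`** for positive definite hermitian `A_i` — the skeleton
`wordPolynomial_mem_lorentzian` of Thms. 4.1 / 4.6 fed with §1 (symmetric, positive) and §4 (slices with at most one
positive eigenvalue); degrees `0`, `1` are the constant `d!·1 > 0` / a positive linear form.
[cite: BrandenHuh2019, §2.1 after Prop. 2.2 (determinantal polynomials are Lorentzian); §4.2 proof of Thm. 4.6 (pp. 49–50,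
the argument)] [cite: ShenfeldVanHandel2019, §1.2 Lemma 1.4] -/
theorem wordPolynomial_mixedDiscWord_mem_lorentzian (hA : ∀ i, (A i).PosDef) :
    ∀ {d : ℕ} (e : ι ≃ Fin d), wordPolynomial d (mixedDiscWord A e) ∈ lorentzian σ d
  | 0, e => wordPolynomial_mem_lorentzian_zero fun u ↦ (mixedDiscWord_pos A e hA u).le
  | 1, e => wordPolynomial_mem_lorentzian_one fun u ↦ (mixedDiscWord_pos A e hA u).le
  | _ + 2, e => wordPolynomial_mem_lorentzian _ (mixedDiscWord A e) (fun π u ↦ mixedDiscWord_comp_perm A e u π)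
      (mixedDiscWord_pos A e hA) fun τ ↦ sigPos_slice_le_one A e (fun i ↦ (hA i).posSemidef) τ

/-- **Brändén–Huh: determinantal polynomials are Lorentzian.** For a finite family of positive definite hermitian
`d × d` matrices `A_i`, `i ∈ σ`, the polynomial `det(Σ_i w_i A_i) ∈ ℝ[w_i]` lies in `L^d_n` (Definition 2.6: nonnegative
coefficients, M-convex support, and every `∂^α det`, `|α| = d - 2`, a quadratic form with at most one positive
eigenvalue). Printed for positive SEMIdefinite `A_i` via stability [BB08] and Prop. 2.2; proved here for positive
definite `A_i` by the mixed-discriminant instance of the Thm. 4.1/4.6 argument (module docstring).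
TODO(general form): positive semidefinite `A_i`. [cite: BrandenHuh2019, §2.1, paragraph after Prop. 2.2 ("determinantal
polynomials […] `det(w_1 A_1 + ⋯ + w_n A_n)`, where `A_1, …, A_n` are positive semidefinite matrices, are stable [BB08],
and hence Lorentzian")] [cite: BorceaBranden2008, Prop. 2.4] -/
theorem detPolynomial_mem_lorentzian (hA : ∀ i, (A i).PosDef) : detPolynomial A ∈ lorentzian σ (Fintype.card ι) :=
  smul_mem_lorentzian (wordPolynomial_mixedDiscWord_mem_lorentzian A hA (Fintype.equivFin ι))
    (inv_nonneg.2 (Nat.cast_nonneg _))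

end Lorentzian

/-! ## §6 Corollary: products of linear forms with positive coefficients (diagonal `A_i`) -/

section LinearForms

variable [Fintype σ] [DecidableEq σ]

omit [Fintype ι] [DecidableEq σ] in
/-- A real combination of the diagonal matrices `diag(c_{·,i})` is the diagonal matrix of the combined entries.
[folklore] -/
private theorem sum_smul_diagonal (c : ι → σ → ℝ) (w : σ → ℝ) :
    ∑ i, (w i : ℂ) • diagonal (fun s ↦ ((c s i : ℝ) : ℂ)) = diagonal fun s ↦ ((∑ i, c s i * w i : ℝ) : ℂ) := by
  ext s t
  rw [Matrix.sum_apply, diagonal_apply]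
  simp only [Matrix.smul_apply, diagonal_apply, smul_eq_mul, mul_ite, mul_zero]
  split_ifs with h
  · push_cast
    exact Finset.sum_congr rfl fun i _ ↦ mul_comm _ _
  · exact Finset.sum_const_zero

/-- The product of linear forms `Π_s (Σ_i c_{s,i} w_i)` is the determinantal polynomial of the diagonal matrices
`A_i = diag(c_{1,i}, …, c_{d,i})`. [cite: BrandenHuh2019, §2.1 after Prop. 2.2 (determinantal polynomials; diagonal case)] -/
theorem prod_linearForm_eq_detPolynomial (c : ι → σ → ℝ) :
    ∏ s, ∑ i, C (c s i) * X i = detPolynomial (fun i ↦ diagonal fun s ↦ ((c s i : ℝ) : ℂ)) := by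
  refine eq_detPolynomial_of_eval_eq _ fun w ↦ ?_
  rw [sum_smul_diagonal, det_diagonal, ← Complex.ofReal_prod, Complex.ofReal_re, map_prod]
  refine Finset.prod_congr rfl fun s _ ↦ ?_
  rw [map_sum]
  exact Finset.sum_congr rfl fun i _ ↦ by rw [map_mul, eval_C, eval_X]

/-- **Products of linear forms with positive coefficients are Lorentzian**: for `c_{s,i} > 0`,
`Π_{s} (Σ_i c_{s,i} w_i) ∈ L^d_n`, `d` the number of factors — the case of diagonal positive definite `A_i` of the
determinantal statement. [cite: BrandenHuh2019, §2.1 after Prop. 2.2 (determinantal polynomials are Lorentzian; diagonal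
`A_i`)] -/
theorem prod_linearForm_mem_lorentzian (c : ι → σ → ℝ) (hc : ∀ s i, 0 < c s i) :
    ∏ s, ∑ i, C (c s i) * X i ∈ lorentzian σ (Fintype.card ι) := by
  rw [prod_linearForm_eq_detPolynomial]
  exact detPolynomial_mem_lorentzian _ fun i ↦
    Matrix.posDef_diagonal_iff.2 fun s ↦ Complex.zero_lt_real.2 (hc s i)

end LinearForms

end Literature.LinearAlgebra.Matrix

end
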